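/-
Copyright (c) 2026. All rights reserved.
Released under Apache 2.0 license as described in the file LICENSE.
-/
import Literature.NumberTheory.ComplexMultiplication.DegenerateCMTypesElementaryAbelianAverageRank
import HarnessLib

/-!
# The joint distribution of two odd character sums over the CM types of an elementary abelian `2`-group, and the
# second moment of the Kubota rank: `Σ_T (rank(T) − 1)² = m(2^m − C(m, m/2)) + m(m−1)(2^m − 2C(m, m/2) + C(m/2, m/4)²)`
# — `136`, `10000`, `11569696` in orders `8`, `16`, `32`

SETTING (tree `CMTypeRankCharacters`, `DegenerateCMTypesElementaryAbelianSignCountDistribution` (g41-#2),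
`DegenerateCMTypesElementaryAbelianAverageRank` (g41-#4); T. Kubota [Kubota1965] §4 Lemma 2, B. Dodson [Dodson1984]
§3.1.1).  `G` a finite commutative group of exponent `2`, `ρ ∈ G`, `ρ ≠ 1`, `T ⊆ G` a CM type (`IsCMTypeWith ρ T`),
`m = |G|/2 = |T|`, `a_χ(T) = #{t ∈ T : χ(t) = −1}` and `Ŝ_T(χ) = Σ_{t∈T} χ(t) = m − 2a_χ(T)` for an odd character `χ`
(`χ(ρ) = −1`), `rank(T) = 1 + #{χ odd : Ŝ_T(χ) ≠ 0}` (Kubota).  For ONE odd `χ` the swap parametrisation of g41-#2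
(`T = R_χ^D`, `R_χ = {χ = 1}` the kernel type, `D = R_χ ∖ T ⊆ R_χ`, `a_χ(T) = |D|`; Dodson: the types are the vectors
of `(ℤ₂)^m`) gives `#{T : a_χ(T) = j} = C(m, j)` and (g41-#4, C. Carlet [Carlet2020] §3.1.8 «`|{f ∈ 𝓑𝓕_n;
W_f(u) = 0}| = C(2ⁿ, 2ⁿ⁻¹)` for every `u` … the average spectral complexity equals `2ⁿ − 2ⁿ·C(2ⁿ, 2ⁿ⁻¹)/2^{2ⁿ}`»)
the first moment `Σ_T (rank(T) − 1) = m(2^m − C(m, m/2))`.  THIS FILE runs the same parametrisation against a SECOND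
odd character `χ' ≠ χ`: the kernel type splits as `R_χ = R₊ ⊔ R₋`, `R_± = {χ = 1, χ' = ±1}`, `|R_±| = m/2` (tree
`four_mul_card_filter_and_eq`), and for `D = A ⊔ B`, `A ⊆ R₊`, `B ⊆ R₋`:
`a_χ(R_χ^D) = |A| + |B|`, `a_{χ'}(R_χ^D) = |A| + (m/2 − |B|)` — in Walsh terms `W_f(u) = X + Y`, `W_f(v) = X − Y` with
`X`, `Y` independent sums of `2ⁿ⁻¹` signs each:

> **Theorem** (`sum_eq_sum_powerset_powerset`, the two-character parametrisation).  For odd `χ ≠ χ'` and every `F`: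
> `Σ_{T CM type} F(a_χ(T), a_{χ'}(T)) = Σ_{A ⊆ R₊} Σ_{B ⊆ R₋} F(|A| + |B|, (|G|/4 − |B|) + |A|)`.
> **Theorem** (`card_filter_sum_char_eq_zero_and_eq`).  For odd `χ ≠ χ'` and `8 ∣ |G|`: **exactly `C(m/2, m/4)²` CM
> types have `Ŝ_T(χ) = Ŝ_T(χ') = 0`**, hence (`card_filter_sum_char_ne_zero_and_ne`) exactly
> `2^m − 2C(m, m/2) + C(m/2, m/4)²` have `Ŝ_T(χ) ≠ 0` and `Ŝ_T(χ') ≠ 0`.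
> **Theorem** (`sum_typeRank_sub_one_sq_eq`).  **`Σ_{T CM type} (rank(T) − 1)² = m(2^m − C(m, m/2)) +
> m(m − 1)(2^m − 2C(m, m/2) + C(m/2, m/4)²)`** (`8 ∣ |G|`).
> **Numerically** (`…_of_card_eq_eight / sixteen / thirtyTwo`): `Σ_T (rank(T) − 1)² = 136 = 1·8 + 16·8` (order `8`),
> `10000 = 1·16 + 16·112 + 64·128` (order `16`), **`11569696 = 1·32 + 16·1120 + 64·3840 + 100·26880 + 256·33664`**
> (order `32`), and `Σ_T rank(T)² = 13320544` in order `32` — the second moment of the tree's order-`32` census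
> (`MultiquadraticCMFieldDegreeThirtyTwoCensus`: `32 + 1120 + 3840 + 26880 + 33664` types of ranks `2/5/9/11/17`),
> obtained here without it.

* §0 helpers.
* §1 `card_filter_sdiff_union_image_eq` (the sign count of a second odd character on a swap `R^D`),
  **`sum_eq_sum_powerset_two`** (`Σ_T F(a_χ, a_{χ'})` as a sum over `D ⊆ R_χ`), **`sum_eq_sum_powerset_powerset`**
  (as a double sum over `A ⊆ R₊`, `B ⊆ R₋`).
* §2 **`card_filter_sum_char_eq_zero_and_eq`** (`C(m/2, m/4)²`), **`card_filter_sum_char_ne_zero_and_ne`**.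
* §3 **`sum_typeRank_sub_one_sq_eq`**, `sum_typeRank_sub_one_sq_of_card_eq_eight` (`136`), `…_sixteen` (`10000`),
  **`sum_typeRank_sub_one_sq_of_card_eq_thirtyTwo`** (`11569696`), `sum_typeRank_sq_of_card_eq_thirtyTwo` (`13320544`).

HONEST SCOPE.  Carlet prints the one-point count `C(2ⁿ, 2ⁿ⁻¹)` and the average spectral complexity; Dodson and
Kubota the parametrisation of the types and the rank formula.  The two-point count and the second moment are this
file's bookkeeping on top of them (the decomposition `W_f(u) = X + Y`, `W_f(v) = X − Y` of two Walsh coefficients of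
a random Boolean function into independent halves).  THEOREMS ONLY: no definition, no named fact, no instance, no
`sorry`.

## References

* [Carlet2020] C. Carlet, *Boolean Functions for Cryptography and Coding Theory*, CUP (2020), §3.1.8 (spectral
  complexity and its average), §2.3 (Walsh transform).
* [Kubota1965] T. Kubota, *On the field extension by complex multiplication*, Trans. AMS 118 (1965), §4 Lemma 2.
* [Dodson1984] B. Dodson, *The structure of Galois groups of CM-fields*, Trans. AMS 283 (1984), §3.1.1 Theorem.
* [Kida2019CountingCMTypes] M. Kida, *Counting formulas for CM-types*, Lemma 2.3 (`2^{|G|/2}` half-systems).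

## Provenance

Lane `lit-hodgefound` (Track 2, Layer A3), seat `lit-hodgefound-p10` generation 41, row g41-#6; neighbours cited
by name, nothing restated: `DegenerateCMTypesElementaryAbelianAverageRank` (`AverageRank.card_filter_sum_char_eq_zero`,
`card_filter_sum_char_ne_zero`, `sum_typeRank_sub_one_eq`, `sum_typeRank_eq`),
`DegenerateCMTypesElementaryAbelianSignCountDistribution` (`SignCount.sdiff_sdiff_union_image_eq`,
`sdiff_union_image_kernel_sdiff_eq`, `card_filter_eq_card_kernel_sdiff`, `sum_eq_sum_powerset`),
`DegenerateCMTypesAbelianSwaps` (`AbelianSwap.isCMTypeWith_sdiff_union_image`, `sdiff_union_image_sdiff_eq`,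
`ExponentTwo.isCMTypeWith_filter_eq_one`, `two_mul_card_filter_eq_one`),
`DegenerateCMTypesElementaryAbelianOrderThirtyTwo` (`four_mul_card_filter_and_eq`, `two_mul_card_odd_eq`),
`DegenerateCMTypesElementaryAbelianTwoGroup` (`sum_char_eq_zero_iff_two_mul_card_filter_eq`), `CMTypeRankCharacters`
(`IsCMTypeWith.typeRank_eq_one_add_ncard_oddCharacters`).
-/

open scoped BigOperators Classical

namespace Literature.NumberTheory.ComplexMultiplication

namespace CyclicCMType

namespace ExponentTwo

namespace SecondMoment

variable {G : Type*} [CommGroup G] [Fintype G] [DecidableEq G] {ρ : G} {T : Finset G}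
  {χ χ' : AddChar (Additive G) ℂ}

/-! ## §0 Helpers -/

section Helpers

omit [Fintype G] [DecidableEq G] in
/-- `g·g = 1` in exponent `2`. [folklore] -/
private theorem mul_self_eq_one_sm (hexp : ∀ g : G, g ^ 2 = 1) (g : G) : g * g = 1 := by
  rw [← pow_two]; exact hexp g

omit [Fintype G] [DecidableEq G] in
/-- Characters of a group of exponent `2` are `±1`-valued. [folklore] -/
private theorem char_eq_one_or_sm (hexp : ∀ g : G, g ^ 2 = 1) (χ : AddChar (Additive G) ℂ) (g : G) :
    χ (Additive.ofMul g) = 1 ∨ χ (Additive.ofMul g) = -1 :=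
  character_apply_eq_one_or_of_mul_self χ (mul_self_eq_one_sm hexp g)

omit [Fintype G] [DecidableEq G] in
/-- `χ(gh) = χ(g)χ(h)`. [folklore] -/
private theorem char_mul_sm (χ : AddChar (Additive G) ℂ) (g h : G) :
    χ (Additive.ofMul (g * h)) = χ (Additive.ofMul g) * χ (Additive.ofMul h) := by
  rw [ofMul_mul, AddChar.map_add_eq_mul]

omit [Fintype G] [DecidableEq G] in
/-- An odd character is non-trivial. [folklore] -/
private theorem ne_zero_of_odd_sm (hχ : χ (Additive.ofMul ρ) = -1) : χ ≠ 0 := by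
  intro h0
  rw [h0, AddChar.zero_apply] at hχ
  norm_num at hχ

omit [Fintype G] [DecidableEq G] in
/-- `χ(g) ≠ 1 ⟺ χ(g) = −1` in exponent `2`. [folklore] -/
private theorem not_eq_one_iff_sm (hexp : ∀ g : G, g ^ 2 = 1) (χ : AddChar (Additive G) ℂ) (g : G) :
    ¬ χ (Additive.ofMul g) = 1 ↔ χ (Additive.ofMul g) = -1 := by
  constructor
  · exact fun h => (char_eq_one_or_sm hexp χ g).resolve_left h
  · intro h h1
    rw [h1] at h
    norm_num at h

omit [DecidableEq G] in
/-- `2|T| = |G|` for a CM type. [folklore] -/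
private theorem two_mul_card_sm (h : IsCMTypeWith ρ (T : Set G)) : 2 * T.card = Fintype.card G := by
  have hρ2 : ρ * ρ = 1 := by
    have := h.invol (1 : G)
    simpa [smul_eq_mul] using this
  have hmem : ∀ x : G, ρ * x ∈ T ↔ x ∉ T := fun x => by
    have := h.rho_smul_mem_iff x
    simpa only [smul_eq_mul, Finset.mem_coe] using this
  have hinj : Function.Injective fun s : G => ρ * s := fun a b hab => mul_left_cancel hab
  have hc : Tᶜ = T.image fun s => ρ * s := by
    ext x
    rw [Finset.mem_compl, Finset.mem_image]
    constructor
    · intro hx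
      refine ⟨ρ * x, (hmem x).2 hx, ?_⟩
      show ρ * (ρ * x) = x
      rw [← mul_assoc, hρ2, one_mul]
    · rintro ⟨s, hs, rfl⟩
      exact fun hx => ((hmem s).1 hx) hs
  have h1 : Tᶜ.card = T.card := by rw [hc, Finset.card_image_of_injective _ hinj]
  have h2 := Finset.card_add_card_compl T
  omega

/-- Kubota's count with the survivors as a finset: `rank(T) = 1 + #{χ odd : Ŝ_T(χ) ≠ 0}`.
[cite: Kubota1965, §4 Lemma 2] -/
private theorem typeRank_eq_one_add_card_sm (h : IsCMTypeWith ρ (T : Set G)) :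
    typeRank G (T : Set G) = 1 + ((Finset.univ.filter fun χ : AddChar (Additive G) ℂ =>
      χ (Additive.ofMul ρ) = -1).filter fun χ => ∑ s ∈ T, χ (Additive.ofMul s) ≠ 0).card := by
  rw [h.typeRank_eq_one_add_ncard_oddCharacters, ← Set.ncard_coe_finset]
  congr 2
  ext χ
  simp only [Set.mem_setOf_eq, Finset.coe_filter, Finset.mem_filter, Finset.mem_univ, true_and]

/-- The total count `2^{|G|/2}` of CM types, through the swap parametrisation of g41-#2 (Kida's count).
[cite: Kida2019CountingCMTypes, Lemma 2.3] -/
private theorem card_types_eq_sm (hexp : ∀ g : G, g ^ 2 = 1) (hχ : χ (Additive.ofMul ρ) = -1) :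
    ((Finset.univ : Finset (Finset G)).filter fun T : Finset G => IsCMTypeWith ρ (T : Set G)).card =
      2 ^ (Fintype.card G / 2) := by
  have hρ2 : ρ * ρ = 1 := mul_self_eq_one_sm hexp ρ
  have hm : (Finset.univ.filter fun g : G => χ (Additive.ofMul g) = 1).card = Fintype.card G / 2 := by
    have := two_mul_card_filter_eq_one hexp (ne_zero_of_odd_sm hχ); omega
  rw [Finset.card_eq_sum_ones, SignCount.sum_eq_sum_powerset hexp hρ2 hχ (fun _ => 1), ← Finset.card_eq_sum_ones,
    Finset.card_powerset, hm]

omit [DecidableEq G] in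
/-- `#{odd characters} = |G|/2`. [cite: Kubota1965, §4 Lemma 2] -/
private theorem card_odd_eq_sm (hexp : ∀ g : G, g ^ 2 = 1) (hχ : χ (Additive.ofMul ρ) = -1) :
    (Finset.univ.filter fun χ : AddChar (Additive G) ℂ => χ (Additive.ofMul ρ) = -1).card = Fintype.card G / 2 := by
  have hR := isCMTypeWith_filter_eq_one hexp (mul_self_eq_one_sm hexp ρ) hχ
  have := two_mul_card_odd_eq hR
  omega

omit [DecidableEq G] in
/-- `|R₋| = |G|/4` for `R₋ = {χ = 1, χ' = −1}`, `χ ≠ χ'` odd (tree `four_mul_card_filter_and_eq`).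
[cite: Kubota1965, §4 Lemma 2] -/
private theorem card_kernel_neg_eq_sm (hexp : ∀ g : G, g ^ 2 = 1) (hχ : χ (Additive.ofMul ρ) = -1)
    (hχ' : χ' (Additive.ofMul ρ) = -1) (hne : χ ≠ χ') :
    (Finset.univ.filter fun g : G => χ (Additive.ofMul g) = 1 ∧ χ' (Additive.ofMul g) = -1).card =
      Fintype.card G / 4 := by
  have := four_mul_card_filter_and_eq hexp (ne_zero_of_odd_sm hχ) (ne_zero_of_odd_sm hχ') (Ne.symm hne)
  omega

omit [DecidableEq G] in
/-- `|R₊| = |G|/4` for `R₊ = {χ = 1, χ' = 1}`, `χ ≠ χ'` odd (`|R_χ| = |G|/2`, `|R₋| = |G|/4`).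
[cite: Kubota1965, §4 Lemma 2] -/
private theorem card_kernel_pos_eq_sm (hexp : ∀ g : G, g ^ 2 = 1) (hχ : χ (Additive.ofMul ρ) = -1)
    (hχ' : χ' (Additive.ofMul ρ) = -1) (hne : χ ≠ χ') :
    (Finset.univ.filter fun g : G => χ (Additive.ofMul g) = 1 ∧ χ' (Additive.ofMul g) = 1).card =
      Fintype.card G / 4 := by
  have h4 := four_mul_card_filter_and_eq hexp (ne_zero_of_odd_sm hχ) (ne_zero_of_odd_sm hχ') (Ne.symm hne)
  have h2 := two_mul_card_filter_eq_one hexp (ne_zero_of_odd_sm hχ)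
  have hsplit := Finset.card_filter_add_card_filter_not
    (s := Finset.univ.filter fun g : G => χ (Additive.ofMul g) = 1) (fun g => χ' (Additive.ofMul g) = 1)
  rw [Finset.filter_filter, Finset.filter_filter] at hsplit
  have hneg : (Finset.univ.filter fun g : G => χ (Additive.ofMul g) = 1 ∧ ¬ χ' (Additive.ofMul g) = 1) =
      Finset.univ.filter fun g : G => χ (Additive.ofMul g) = 1 ∧ χ' (Additive.ofMul g) = -1 :=
    Finset.filter_congr fun g _ => by rw [not_eq_one_iff_sm hexp χ' g]
  rw [hneg] at hsplit
  omega

end Helpers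

/-! ## §1 The two-character swap parametrisation -/

section Parametrisation

omit [Fintype G] in
/-- `R ∖ D` and `ρD` are disjoint for `D ⊆ R ⊆ {χ = 1}`, `χ` odd (`ρD ⊆ {χ = −1}`). [folklore] -/
private theorem disjoint_sdiff_image_sm (hχ : χ (Additive.ofMul ρ) = -1) {R D : Finset G}
    (hR : ∀ r ∈ R, χ (Additive.ofMul r) = 1) (hD : D ⊆ R) : Disjoint (R \ D) (D.image fun d => ρ * d) := by
  rw [Finset.disjoint_left]
  intro x hx hx'
  obtain ⟨d, hd, rfl⟩ := Finset.mem_image.1 hx'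
  have h1 : χ (Additive.ofMul (ρ * d)) = -1 := by rw [char_mul_sm, hχ, hR d (hD hd)]; norm_num
  rw [hR _ (Finset.mem_sdiff.1 hx).1] at h1
  norm_num at h1

omit [Fintype G] in
/-- **THE SIGN COUNT OF A SECOND ODD CHARACTER ON A SWAP**: for `D ⊆ R ⊆ {χ = 1}`, `χ`, `χ'` odd and the swap
`R^D = (R ∖ D) ∪ ρD`: `a_{χ'}(R^D) = #{r ∈ R ∖ D : χ'(r) = −1} + #{d ∈ D : χ'(d) = 1}` (`χ'(ρd) = −χ'(d)`).
[cite: Dodson1984, §3.1.1 Theorem] [cite: Kubota1965, §4 Lemma 2] -/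
theorem card_filter_sdiff_union_image_eq (hχ : χ (Additive.ofMul ρ) = -1) (hχ' : χ' (Additive.ofMul ρ) = -1)
    {R D : Finset G} (hR : ∀ r ∈ R, χ (Additive.ofMul r) = 1) (hD : D ⊆ R) :
    (((R \ D) ∪ D.image (fun d => ρ * d)).filter fun s => χ' (Additive.ofMul s) = -1).card =
      ((R \ D).filter fun s => χ' (Additive.ofMul s) = -1).card +
        (D.filter fun d => χ' (Additive.ofMul d) = 1).card := by
  have hinj : Function.Injective fun d : G => ρ * d := fun a b hab => mul_left_cancel hab
  have hfilter : (D.filter fun d => χ' (Additive.ofMul (ρ * d)) = -1) =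
      D.filter fun d => χ' (Additive.ofMul d) = 1 :=
    Finset.filter_congr fun d _ => by rw [char_mul_sm, hχ', neg_one_mul, neg_inj]
  rw [Finset.filter_union, Finset.card_union_of_disjoint
    (Finset.disjoint_filter_filter (disjoint_sdiff_image_sm hχ hR hD)), Finset.filter_image,
    Finset.card_image_of_injective _ hinj, hfilter]

/-- **`Σ_{T CM type} F(a_χ(T), a_{χ'}(T)) = Σ_{D ⊆ R_χ} F(|D|, #{r ∈ R_χ ∖ D : χ'(r) = −1} + #{d ∈ D : χ'(d) = 1})`**:
the swap parametrisation `T = R_χ^D`, `D = R_χ ∖ T` of the CM types by the subsets of the kernel type `R_χ = {χ = 1}`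
(tree `SignCount.sum_eq_sum_powerset`, which carries `a_χ(T) = |D|` only) followed along a second odd character.
[cite: Dodson1984, §3.1.1 Theorem] [cite: Kubota1965, §2] -/
theorem sum_eq_sum_powerset_two {M : Type*} [AddCommMonoid M] (hexp : ∀ g : G, g ^ 2 = 1) (hρ2 : ρ * ρ = 1)
    (hχ : χ (Additive.ofMul ρ) = -1) (hχ' : χ' (Additive.ofMul ρ) = -1) (F : ℕ → ℕ → M) :
    ∑ T ∈ (Finset.univ : Finset (Finset G)).filter (fun T : Finset G => IsCMTypeWith ρ (T : Set G)),
        F (T.filter fun s => χ (Additive.ofMul s) = -1).card (T.filter fun s => χ' (Additive.ofMul s) = -1).card =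
      ∑ D ∈ (Finset.univ.filter fun g : G => χ (Additive.ofMul g) = 1).powerset,
        F D.card ((((Finset.univ.filter fun g : G => χ (Additive.ofMul g) = 1) \ D).filter
            fun s => χ' (Additive.ofMul s) = -1).card + (D.filter fun d => χ' (Additive.ofMul d) = 1).card) := by
  set R := Finset.univ.filter fun g : G => χ (Additive.ofMul g) = 1 with hR
  have hRtype : IsCMTypeWith ρ (R : Set G) := isCMTypeWith_filter_eq_one hexp hρ2 hχ
  have hRχ : ∀ r ∈ R, χ (Additive.ofMul r) = 1 := fun r hr => (Finset.mem_filter.1 hr).2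
  refine Finset.sum_nbij' (fun T => R \ T) (fun D => (R \ D) ∪ D.image (fun d => ρ * d)) ?_ ?_ ?_ ?_ ?_
  · intro T _
    exact Finset.mem_powerset.2 Finset.sdiff_subset
  · intro D hD
    simp only [Finset.mem_filter, Finset.mem_univ, true_and]
    exact AbelianSwap.isCMTypeWith_sdiff_union_image hRtype (Finset.mem_powerset.1 hD)
  · intro T hT
    exact AbelianSwap.sdiff_union_image_sdiff_eq hRtype (Finset.mem_filter.1 hT).2
  · intro D hD
    exact SignCount.sdiff_sdiff_union_image_eq hχ hRχ (Finset.mem_powerset.1 hD)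
  · intro T hT
    have hTt : IsCMTypeWith ρ (T : Set G) := (Finset.mem_filter.1 hT).2
    have hswap := card_filter_sdiff_union_image_eq hχ hχ' hRχ (Finset.sdiff_subset (s := R) (t := T))
    rw [AbelianSwap.sdiff_union_image_sdiff_eq hRtype hTt] at hswap
    rw [SignCount.card_filter_eq_card_kernel_sdiff hexp hTt hχ, hswap]

omit [CommGroup G] [Fintype G] in
/-- **A sum over the subsets of `R` is a double sum over the subsets of `{p}` and of `{¬p}`** (`D = A ⊔ B`,
`A = D ∩ {p}`, `B = D ∩ {¬p}`). [folklore] -/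
private theorem sum_powerset_eq_sum_sum_sm {M : Type*} [AddCommMonoid M] (R : Finset G) (p : G → Prop)
    [DecidablePred p] (F : Finset G → M) :
    ∑ D ∈ R.powerset, F D =
      ∑ A ∈ (R.filter p).powerset, ∑ B ∈ (R.filter fun g => ¬ p g).powerset, F (A ∪ B) := by
  rw [← Finset.sum_product' (R.filter p).powerset (R.filter fun g => ¬ p g).powerset (fun A B => F (A ∪ B))]
  refine Finset.sum_nbij' (fun D => (D.filter p, D.filter fun g => ¬ p g)) (fun AB => AB.1 ∪ AB.2) ?_ ?_ ?_ ?_ ?_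
  · intro D hD
    have hDR := Finset.mem_powerset.1 hD
    rw [Finset.mem_product]
    exact ⟨Finset.mem_powerset.2 (Finset.filter_subset_filter p hDR),
      Finset.mem_powerset.2 (Finset.filter_subset_filter _ hDR)⟩
  · intro AB hAB
    rw [Finset.mem_product] at hAB
    exact Finset.mem_powerset.2 (Finset.union_subset
      ((Finset.mem_powerset.1 hAB.1).trans (Finset.filter_subset _ _))
      ((Finset.mem_powerset.1 hAB.2).trans (Finset.filter_subset _ _)))
  · intro D _
    exact Finset.filter_union_filter_not_eq (p := p) D
  · rintro ⟨A, B⟩ hAB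
    rw [Finset.mem_product] at hAB
    obtain ⟨hA, hB⟩ := hAB
    have hA' : ∀ a ∈ A, p a := fun a ha => (Finset.mem_filter.1 (Finset.mem_powerset.1 hA ha)).2
    have hB' : ∀ b ∈ B, ¬ p b := fun b hb => (Finset.mem_filter.1 (Finset.mem_powerset.1 hB hb)).2
    refine Prod.ext ?_ ?_
    · show (A ∪ B).filter p = A
      rw [Finset.filter_union, Finset.filter_true_of_mem hA', Finset.filter_false_of_mem hB', Finset.union_empty]
    · show ((A ∪ B).filter fun g => ¬ p g) = B
      rw [Finset.filter_union, Finset.filter_false_of_mem (fun a ha => not_not.2 (hA' a ha)),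
        Finset.filter_true_of_mem hB', Finset.empty_union]
  · intro D _
    show F D = F (D.filter p ∪ D.filter fun g => ¬ p g)
    rw [Finset.filter_union_filter_not_eq]

/-- **THE TWO-CHARACTER PARAMETRISATION**: for odd characters `χ ≠ χ'` with `R₊ = {χ = 1, χ' = 1}`,
`R₋ = {χ = 1, χ' = −1}` (`|R₋| = |G|/4`), the CM types correspond to the pairs `(A, B)`, `A ⊆ R₊`, `B ⊆ R₋`
(`T = R_χ^{A ⊔ B}`), with `a_χ(T) = |A| + |B|` and `a_{χ'}(T) = (|G|/4 − |B|) + |A|`: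
`Σ_{T CM type} F(a_χ(T), a_{χ'}(T)) = Σ_{A ⊆ R₊} Σ_{B ⊆ R₋} F(|A| + |B|, (|G|/4 − |B|) + |A|)` — two Walsh coefficients
`W_f(u) = X + Y`, `W_f(v) = X − Y` of a random Boolean function split into independent halves.
[cite: Dodson1984, §3.1.1 Theorem] [cite: Kubota1965, §4 Lemma 2] -/
theorem sum_eq_sum_powerset_powerset {M : Type*} [AddCommMonoid M] (hexp : ∀ g : G, g ^ 2 = 1) (hρ2 : ρ * ρ = 1)
    (hχ : χ (Additive.ofMul ρ) = -1) (hχ' : χ' (Additive.ofMul ρ) = -1) (hne : χ ≠ χ') (F : ℕ → ℕ → M) :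
    ∑ T ∈ (Finset.univ : Finset (Finset G)).filter (fun T : Finset G => IsCMTypeWith ρ (T : Set G)),
        F (T.filter fun s => χ (Additive.ofMul s) = -1).card (T.filter fun s => χ' (Additive.ofMul s) = -1).card =
      ∑ A ∈ (Finset.univ.filter fun g : G => χ (Additive.ofMul g) = 1 ∧ χ' (Additive.ofMul g) = 1).powerset,
        ∑ B ∈ (Finset.univ.filter fun g : G => χ (Additive.ofMul g) = 1 ∧ χ' (Additive.ofMul g) = -1).powerset,
          F (A.card + B.card) ((Fintype.card G / 4 - B.card) + A.card) := by
  rw [sum_eq_sum_powerset_two hexp hρ2 hχ hχ' F,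
    sum_powerset_eq_sum_sum_sm (Finset.univ.filter fun g : G => χ (Additive.ofMul g) = 1)
      (fun g => χ' (Additive.ofMul g) = 1), Finset.filter_filter, Finset.filter_filter]
  have hneg : (Finset.univ.filter fun g : G => χ (Additive.ofMul g) = 1 ∧ ¬ χ' (Additive.ofMul g) = 1) =
      Finset.univ.filter fun g : G => χ (Additive.ofMul g) = 1 ∧ χ' (Additive.ofMul g) = -1 :=
    Finset.filter_congr fun g _ => by rw [not_eq_one_iff_sm hexp χ' g]
  rw [hneg]
  have hRm := card_kernel_neg_eq_sm hexp hχ hχ' hne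
  refine Finset.sum_congr rfl fun A hA => Finset.sum_congr rfl fun B hB => ?_
  have hA' : ∀ a ∈ A, χ (Additive.ofMul a) = 1 ∧ χ' (Additive.ofMul a) = 1 :=
    fun a ha => (Finset.mem_filter.1 (Finset.mem_powerset.1 hA ha)).2
  have hB' : ∀ b ∈ B, χ (Additive.ofMul b) = 1 ∧ χ' (Additive.ofMul b) = -1 :=
    fun b hb => (Finset.mem_filter.1 (Finset.mem_powerset.1 hB hb)).2
  have hAB : Disjoint A B := by
    rw [Finset.disjoint_left]
    intro x hxA hxB
    have h1 := (hA' x hxA).2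
    rw [(hB' x hxB).2] at h1
    norm_num at h1
  -- `|A ⊔ B| = |A| + |B|`
  have hcard : (A ∪ B).card = A.card + B.card := Finset.card_union_of_disjoint hAB
  -- `#{d ∈ A ⊔ B : χ'(d) = 1} = |A|`
  have hone : ((A ∪ B).filter fun d => χ' (Additive.ofMul d) = 1) = A := by
    rw [Finset.filter_union, Finset.filter_true_of_mem fun a ha => (hA' a ha).2,
      Finset.filter_false_of_mem fun b hb => by rw [(hB' b hb).2]; norm_num, Finset.union_empty]
  -- `#{r ∈ R ∖ (A ⊔ B) : χ'(r) = −1} = |R₋| − |B|`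
  have hsd : (((Finset.univ.filter fun g : G => χ (Additive.ofMul g) = 1) \ (A ∪ B)).filter
      fun s => χ' (Additive.ofMul s) = -1) =
      (Finset.univ.filter fun g : G => χ (Additive.ofMul g) = 1 ∧ χ' (Additive.ofMul g) = -1) \ B := by
    ext x
    simp only [Finset.mem_filter, Finset.mem_sdiff, Finset.mem_union, Finset.mem_univ, true_and, not_or]
    constructor
    · rintro ⟨⟨hx1, -, hxB⟩, hx2⟩
      exact ⟨⟨hx1, hx2⟩, hxB⟩
    · rintro ⟨⟨hx1, hx2⟩, hxB⟩
      refine ⟨⟨hx1, fun hxA => ?_, hxB⟩, hx2⟩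
      have := (hA' x hxA).2
      rw [hx2] at this
      norm_num at this
  rw [hcard, hone, hsd, Finset.card_sdiff_of_subset (Finset.mem_powerset.1 hB), hRm]

end Parametrisation

/-! ## §2 The joint counts -/

section Counts

/-- **EXACTLY `C(m/2, m/4)²` CM TYPES KILL TWO GIVEN ODD CHARACTERS** (`χ ≠ χ'`, `m = |G|/2`, `8 ∣ |G|`):
`Ŝ_T(χ) = Ŝ_T(χ') = 0 ⟺ |A| + |B| = m/2 ∧ |A| − |B| + m/2 = m/2 ⟺ |A| = |B| = m/4` in the two-character
parametrisation — `#{f : W_f(u) = W_f(v) = 0} = C(2ⁿ⁻¹, 2ⁿ⁻²)²` for `u ≠ v`, against Carlet's one-point count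
`C(2ⁿ, 2ⁿ⁻¹)`. [cite: Carlet2020, §3.1.8] [cite: Dodson1984, §3.1.1 Theorem] -/
theorem card_filter_sum_char_eq_zero_and_eq (hexp : ∀ g : G, g ^ 2 = 1) (h8 : 8 ∣ Fintype.card G)
    (hχ : χ (Additive.ofMul ρ) = -1) (hχ' : χ' (Additive.ofMul ρ) = -1) (hne : χ ≠ χ') :
    ((Finset.univ : Finset (Finset G)).filter fun T : Finset G =>
      IsCMTypeWith ρ (T : Set G) ∧ ∑ s ∈ T, χ (Additive.ofMul s) = 0 ∧ ∑ s ∈ T, χ' (Additive.ofMul s) = 0).card =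
      (Fintype.card G / 4).choose (Fintype.card G / 8) ^ 2 := by
  have hρ2 : ρ * ρ = 1 := mul_self_eq_one_sm hexp ρ
  obtain ⟨c, hc⟩ := h8
  have hG4 : Fintype.card G / 4 = 2 * c := by rw [hc]; omega
  have hG8 : Fintype.card G / 8 = c := by rw [hc]; omega
  have hG2 : Fintype.card G / 2 = 4 * c := by rw [hc]; omega
  -- the condition as a function of the two sign counts
  have step1 : ((Finset.univ : Finset (Finset G)).filter fun T : Finset G =>
      IsCMTypeWith ρ (T : Set G) ∧ ∑ s ∈ T, χ (Additive.ofMul s) = 0 ∧ ∑ s ∈ T, χ' (Additive.ofMul s) = 0) =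
      ((Finset.univ : Finset (Finset G)).filter fun T : Finset G => IsCMTypeWith ρ (T : Set G)).filter
        fun T : Finset G => 2 * (T.filter fun s => χ (Additive.ofMul s) = -1).card = 4 * c ∧
          2 * (T.filter fun s => χ' (Additive.ofMul s) = -1).card = 4 * c := by
    rw [Finset.filter_filter]
    refine Finset.filter_congr fun T _ => and_congr_right fun hT => ?_
    have hTc : T.card = 4 * c := by have := two_mul_card_sm hT; omega
    rw [sum_char_eq_zero_iff_two_mul_card_filter_eq hexp χ T, sum_char_eq_zero_iff_two_mul_card_filter_eq hexp χ' T,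
      hTc]
  rw [step1, Finset.card_filter,
    sum_eq_sum_powerset_powerset hexp hρ2 hχ hχ' hne (fun a b => if 2 * a = 4 * c ∧ 2 * b = 4 * c then 1 else 0),
    hG4, hG8]
  -- `2(|A| + |B|) = 4c ∧ 2((2c − |B|) + |A|) = 4c ⟺ |A| = c ∧ |B| = c`
  set Rp := Finset.univ.filter fun g : G => χ (Additive.ofMul g) = 1 ∧ χ' (Additive.ofMul g) = 1 with hRp
  set Rm := Finset.univ.filter fun g : G => χ (Additive.ofMul g) = 1 ∧ χ' (Additive.ofMul g) = -1 with hRm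
  have hRmc : Rm.card = 2 * c := by rw [hRm, card_kernel_neg_eq_sm hexp hχ hχ' hne, hG4]
  have hRpc : Rp.card = 2 * c := by rw [hRp, card_kernel_pos_eq_sm hexp hχ hχ' hne, hG4]
  calc ∑ A ∈ Rp.powerset, ∑ B ∈ Rm.powerset,
        (if 2 * (A.card + B.card) = 4 * c ∧ 2 * ((2 * c - B.card) + A.card) = 4 * c then 1 else 0)
      = ∑ A ∈ Rp.powerset, ∑ B ∈ Rm.powerset, (if A.card = c then 1 else 0) * (if B.card = c then 1 else 0) := by
        refine Finset.sum_congr rfl fun A _ => Finset.sum_congr rfl fun B hB => ?_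
        have hBle : B.card ≤ 2 * c := hRmc ▸ Finset.card_le_card (Finset.mem_powerset.1 hB)
        by_cases hA : A.card = c
        · by_cases hBc : B.card = c
          · rw [if_pos hA, if_pos hBc, if_pos (by omega)]
          · rw [if_pos hA, if_neg hBc, if_neg (by omega)]
        · rw [if_neg hA, if_neg (by omega), zero_mul]
    _ = (∑ A ∈ Rp.powerset, if A.card = c then 1 else 0) * ∑ B ∈ Rm.powerset, (if B.card = c then 1 else 0) := by
        rw [Finset.sum_mul_sum]
    _ = (Rp.powerset.filter fun A => A.card = c).card * (Rm.powerset.filter fun B => B.card = c).card := by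
        rw [Finset.card_filter, Finset.card_filter]
    _ = (2 * c).choose c ^ 2 := by
        rw [← Finset.powersetCard_eq_filter, ← Finset.powersetCard_eq_filter, Finset.card_powersetCard,
          Finset.card_powersetCard, hRpc, hRmc, sq]

/-- **`#{T : Ŝ_T(χ) ≠ 0 ∧ Ŝ_T(χ') ≠ 0} = 2^m − 2C(m, m/2) + C(m/2, m/4)²`** for odd `χ ≠ χ'` (`m = |G|/2`,
`8 ∣ |G|`; inclusion–exclusion with the one-point counts `C(m, m/2)` of g41-#4 and Kida's total `2^m`; stated as
`2^m + C(m/2, m/4)² − 2C(m, m/2)` in `ℕ`). [cite: Carlet2020, §3.1.8] [cite: Kida2019CountingCMTypes, Lemma 2.3] -/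
theorem card_filter_sum_char_ne_zero_and_ne (hexp : ∀ g : G, g ^ 2 = 1) (h8 : 8 ∣ Fintype.card G)
    (hχ : χ (Additive.ofMul ρ) = -1) (hχ' : χ' (Additive.ofMul ρ) = -1) (hne : χ ≠ χ') :
    ((Finset.univ : Finset (Finset G)).filter fun T : Finset G =>
      IsCMTypeWith ρ (T : Set G) ∧ ∑ s ∈ T, χ (Additive.ofMul s) ≠ 0 ∧ ∑ s ∈ T, χ' (Additive.ofMul s) ≠ 0).card =
      2 ^ (Fintype.card G / 2) + (Fintype.card G / 4).choose (Fintype.card G / 8) ^ 2 -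
        2 * (Fintype.card G / 2).choose (Fintype.card G / 4) := by
  have h4 : 4 ∣ Fintype.card G := (show (4 : ℕ) ∣ 8 by norm_num).trans h8
  have htot := card_types_eq_sm hexp hχ
  have hz := AverageRank.card_filter_sum_char_eq_zero hexp h4 hχ
  have hz' := AverageRank.card_filter_sum_char_eq_zero hexp h4 hχ'
  have hzz := card_filter_sum_char_eq_zero_and_eq hexp h8 hχ hχ' hne
  set CM := (Finset.univ : Finset (Finset G)).filter fun T : Finset G => IsCMTypeWith ρ (T : Set G) with hCM
  -- pointwise inclusion–exclusion: `[a ≠ 0 ∧ b ≠ 0] + [a = 0] + [b = 0] = 1 + [a = 0 ∧ b = 0]`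
  have hpt : ∀ T : Finset G,
      (if ∑ s ∈ T, χ (Additive.ofMul s) ≠ 0 ∧ ∑ s ∈ T, χ' (Additive.ofMul s) ≠ 0 then 1 else 0) +
        (if ∑ s ∈ T, χ (Additive.ofMul s) = 0 then 1 else 0) +
        (if ∑ s ∈ T, χ' (Additive.ofMul s) = 0 then 1 else 0) =
      1 + (if ∑ s ∈ T, χ (Additive.ofMul s) = 0 ∧ ∑ s ∈ T, χ' (Additive.ofMul s) = 0 then 1 else 0) := by
    intro T
    by_cases ha : ∑ s ∈ T, χ (Additive.ofMul s) = 0 <;> by_cases hb : ∑ s ∈ T, χ' (Additive.ofMul s) = 0 <;>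
      simp [ha, hb]
  have hsum := Finset.sum_congr rfl fun T (_ : T ∈ CM) => hpt T
  rw [Finset.sum_add_distrib, Finset.sum_add_distrib, Finset.sum_add_distrib, ← Finset.card_filter,
    ← Finset.card_filter, ← Finset.card_filter, ← Finset.card_filter, Finset.sum_const, smul_eq_mul, mul_one,
    hCM, Finset.filter_filter, Finset.filter_filter, Finset.filter_filter, Finset.filter_filter, htot, hz, hz',
    hzz] at hsum
  omega

end Counts

/-! ## §3 The second moment of the Kubota rank -/

section Moment

/-- **`Σ_{T CM type} (rank(T) − 1)² = m(2^m − C(m, m/2)) + m(m − 1)(2^m − 2C(m, m/2) + C(m/2, m/4)²)`**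
(`m = |G|/2`, `8 ∣ |G|`): `(rank − 1)² = Σ_{χ, χ' odd} [Ŝ_T(χ) ≠ 0][Ŝ_T(χ') ≠ 0]`, exchanged with the sum over the
types; the diagonal gives `m` times the one-point count `2^m − C(m, m/2)` (g41-#4), the `m(m−1)` off-diagonal pairs
the two-point count. [cite: Carlet2020, §3.1.8] [cite: Kubota1965, §4 Lemma 2] -/
theorem sum_typeRank_sub_one_sq_eq (hexp : ∀ g : G, g ^ 2 = 1) (hρ1 : ρ ≠ 1) (h8 : 8 ∣ Fintype.card G) :
    ∑ T ∈ (Finset.univ : Finset (Finset G)).filter (fun T : Finset G => IsCMTypeWith ρ (T : Set G)),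
        (typeRank G (T : Set G) - 1) ^ 2 =
      Fintype.card G / 2 * (2 ^ (Fintype.card G / 2) - (Fintype.card G / 2).choose (Fintype.card G / 4)) +
        Fintype.card G / 2 * (Fintype.card G / 2 - 1) *
          (2 ^ (Fintype.card G / 2) + (Fintype.card G / 4).choose (Fintype.card G / 8) ^ 2 -
            2 * (Fintype.card G / 2).choose (Fintype.card G / 4)) := by
  have hρ2 : ρ * ρ = 1 := mul_self_eq_one_sm hexp ρ
  have h4 : 4 ∣ Fintype.card G := (show (4 : ℕ) ∣ 8 by norm_num).trans h8
  set O := Finset.univ.filter (fun χ : AddChar (Additive G) ℂ => χ (Additive.ofMul ρ) = -1) with hO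
  set CM := (Finset.univ : Finset (Finset G)).filter fun T : Finset G => IsCMTypeWith ρ (T : Set G) with hCM
  -- `(rank − 1)² = Σ_{χ ∈ O} Σ_{χ' ∈ O} [Ŝχ ≠ 0 ∧ Ŝχ' ≠ 0]`
  have step : ∀ T ∈ CM, (typeRank G (T : Set G) - 1) ^ 2 =
      ∑ χ ∈ O, ∑ χ' ∈ O, (if ∑ s ∈ T, χ (Additive.ofMul s) ≠ 0 ∧ ∑ s ∈ T, χ' (Additive.ofMul s) ≠ 0
        then 1 else 0) := by
    intro T hT
    rw [typeRank_eq_one_add_card_sm (Finset.mem_filter.1 hT).2, Nat.add_sub_cancel_left, sq, Finset.card_filter,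
      Finset.sum_mul_sum]
    refine Finset.sum_congr rfl fun χ _ => Finset.sum_congr rfl fun χ' _ => ?_
    by_cases ha : ∑ s ∈ T, χ (Additive.ofMul s) ≠ 0 <;> by_cases hb : ∑ s ∈ T, χ' (Additive.ofMul s) ≠ 0 <;>
      simp [ha, hb]
  rw [Finset.sum_congr rfl step, Finset.sum_comm]
  -- for each `χ`: `Σ_{χ'} #{T : …} = (2^m − C) + (m − 1)·N₂`
  have inner : ∀ χ ∈ O, ∑ T ∈ CM, ∑ χ' ∈ O,
      (if ∑ s ∈ T, χ (Additive.ofMul s) ≠ 0 ∧ ∑ s ∈ T, χ' (Additive.ofMul s) ≠ 0 then 1 else 0) =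
      (2 ^ (Fintype.card G / 2) - (Fintype.card G / 2).choose (Fintype.card G / 4)) +
        (Fintype.card G / 2 - 1) * (2 ^ (Fintype.card G / 2) + (Fintype.card G / 4).choose (Fintype.card G / 8) ^ 2 -
          2 * (Fintype.card G / 2).choose (Fintype.card G / 4)) := by
    intro χ hχO
    have hχ : χ (Additive.ofMul ρ) = -1 := (Finset.mem_filter.1 hχO).2
    rw [Finset.sum_comm, ← Finset.add_sum_erase O _ hχO]
    congr 1
    · -- the diagonal term
      rw [← Finset.card_filter, Finset.filter_filter, ← AverageRank.card_filter_sum_char_ne_zero hexp h4 hχ]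
      congr 1
      exact Finset.filter_congr fun T _ => and_congr_right fun _ => and_self_iff
    · -- the off-diagonal terms
      have hoff : ∀ χ' ∈ O.erase χ, ∑ T ∈ CM,
          (if ∑ s ∈ T, χ (Additive.ofMul s) ≠ 0 ∧ ∑ s ∈ T, χ' (Additive.ofMul s) ≠ 0 then 1 else 0) =
          2 ^ (Fintype.card G / 2) + (Fintype.card G / 4).choose (Fintype.card G / 8) ^ 2 -
            2 * (Fintype.card G / 2).choose (Fintype.card G / 4) := by
        intro χ' hχ'
        obtain ⟨hne, hχ'O⟩ := Finset.mem_erase.1 hχ'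
        rw [← Finset.card_filter, Finset.filter_filter]
        exact card_filter_sum_char_ne_zero_and_ne hexp h8 hχ (Finset.mem_filter.1 hχ'O).2 (Ne.symm hne)
      rw [Finset.sum_congr rfl hoff, Finset.sum_const, smul_eq_mul, Finset.card_erase_of_mem hχO,
        card_odd_eq_sm hexp hχ]
  rw [Finset.sum_congr rfl inner, Finset.sum_const, smul_eq_mul]
  -- `m` odd characters
  have hρ0 : (Additive.ofMul ρ : Additive G) ≠ 0 := fun h0 => hρ1 (by simpa using congrArg Additive.toMul h0)
  obtain ⟨χ₀, hχ₀'⟩ := (AddChar.exists_apply_ne_zero (α := Additive G)).2 hρ0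
  have hχ₀ : χ₀ (Additive.ofMul ρ) = -1 := (character_apply_eq_one_or_of_mul_self χ₀ hρ2).resolve_left hχ₀'
  rw [card_odd_eq_sm hexp hχ₀]
  ring

/-- **Order `8`: `Σ_T (rank(T) − 1)² = 136`** over the `16` CM types (`= 1·8 + 16·8`: `8` of rank `2`, `8` of rank
`5`). [cite: Carlet2020, §3.1.8] [cite: Kubota1965, §4 Lemma 2] -/
theorem sum_typeRank_sub_one_sq_of_card_eq_eight (hexp : ∀ g : G, g ^ 2 = 1) (hρ1 : ρ ≠ 1)
    (h8 : Fintype.card G = 8) :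
    ∑ T ∈ (Finset.univ : Finset (Finset G)).filter (fun T : Finset G => IsCMTypeWith ρ (T : Set G)),
        (typeRank G (T : Set G) - 1) ^ 2 = 136 := by
  rw [sum_typeRank_sub_one_sq_eq hexp hρ1 (by rw [h8]), h8]
  decide

/-- **Order `16`: `Σ_T (rank(T) − 1)² = 10000`** over the `256` CM types (`= 1·16 + 16·112 + 64·128`, the tree's
order-`16` census `16/112/128` of ranks `2/5/9`). [cite: Carlet2020, §3.1.8] [cite: Kubota1965, §4 Lemma 2] -/
theorem sum_typeRank_sub_one_sq_of_card_eq_sixteen (hexp : ∀ g : G, g ^ 2 = 1) (hρ1 : ρ ≠ 1)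
    (h16 : Fintype.card G = 16) :
    ∑ T ∈ (Finset.univ : Finset (Finset G)).filter (fun T : Finset G => IsCMTypeWith ρ (T : Set G)),
        (typeRank G (T : Set G) - 1) ^ 2 = 10000 := by
  rw [sum_typeRank_sub_one_sq_eq hexp hρ1 (by rw [h16]; norm_num), h16]
  decide

/-- **ORDER `32`: `Σ_T (rank(T) − 1)² = 11569696`** over the `65536` CM types — `= 16·(65536 − 12870) +
240·(65536 − 25740 + 4900)`, and also `= 1·32 + 16·1120 + 64·3840 + 100·26880 + 256·33664`, the second moment of the
tree's order-`32` census (`MultiquadraticCMFieldDegreeThirtyTwoCensus`), obtained here without it.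
[cite: Carlet2020, §3.1.8] [cite: Kubota1965, §4 Lemma 2] -/
theorem sum_typeRank_sub_one_sq_of_card_eq_thirtyTwo (hexp : ∀ g : G, g ^ 2 = 1) (hρ1 : ρ ≠ 1)
    (h32 : Fintype.card G = 32) :
    ∑ T ∈ (Finset.univ : Finset (Finset G)).filter (fun T : Finset G => IsCMTypeWith ρ (T : Set G)),
        (typeRank G (T : Set G) - 1) ^ 2 = 11569696 := by
  rw [sum_typeRank_sub_one_sq_eq hexp hρ1 (by rw [h32]; norm_num), h32]
  decide

/-- **ORDER `32`: `Σ_T rank(T)² = 13320544`** (`= 4·32 + 25·1120 + 81·3840 + 121·26880 + 289·33664`; from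
`rank² = (rank − 1)² + 2(rank − 1) + 1`, the first moment `908192 − 65536` of g41-#4 and the `65536` types).
[cite: Carlet2020, §3.1.8] [cite: Kubota1965, §4 Lemma 2] [cite: Kida2019CountingCMTypes, Lemma 2.3] -/
theorem sum_typeRank_sq_of_card_eq_thirtyTwo (hexp : ∀ g : G, g ^ 2 = 1) (hρ1 : ρ ≠ 1)
    (h32 : Fintype.card G = 32) :
    ∑ T ∈ (Finset.univ : Finset (Finset G)).filter (fun T : Finset G => IsCMTypeWith ρ (T : Set G)),
        typeRank G (T : Set G) ^ 2 = 13320544 := by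
  have hρ2 : ρ * ρ = 1 := mul_self_eq_one_sm hexp ρ
  have hρ0 : (Additive.ofMul ρ : Additive G) ≠ 0 := fun h0 => hρ1 (by simpa using congrArg Additive.toMul h0)
  obtain ⟨χ₀, hχ₀'⟩ := (AddChar.exists_apply_ne_zero (α := Additive G)).2 hρ0
  have hχ₀ : χ₀ (Additive.ofMul ρ) = -1 := (character_apply_eq_one_or_of_mul_self χ₀ hρ2).resolve_left hχ₀'
  have htot := card_types_eq_sm hexp hχ₀
  rw [h32] at htot
  have h2 := sum_typeRank_sub_one_sq_of_card_eq_thirtyTwo hexp hρ1 h32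
  have h1 : ∑ T ∈ (Finset.univ : Finset (Finset G)).filter (fun T : Finset G => IsCMTypeWith ρ (T : Set G)),
      (typeRank G (T : Set G) - 1) = 842656 := by
    rw [AverageRank.sum_typeRank_sub_one_eq hexp hρ1 (by rw [h32]; norm_num), h32]
    decide
  have step : ∀ T ∈ (Finset.univ : Finset (Finset G)).filter (fun T : Finset G => IsCMTypeWith ρ (T : Set G)),
      typeRank G (T : Set G) ^ 2 = (typeRank G (T : Set G) - 1) ^ 2 + 2 * (typeRank G (T : Set G) - 1) + 1 := by
    intro T hT
    have h1le : 1 ≤ typeRank G (T : Set G) := by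
      rw [typeRank_eq_one_add_card_sm (Finset.mem_filter.1 hT).2]; omega
    obtain ⟨r, hr⟩ := Nat.exists_eq_add_of_le h1le
    rw [hr, Nat.add_sub_cancel_left]
    ring
  rw [Finset.sum_congr rfl step, Finset.sum_add_distrib, Finset.sum_add_distrib, h2, ← Finset.mul_sum, h1,
    Finset.sum_const, smul_eq_mul, mul_one, htot]
  norm_num

end Moment

end SecondMoment

end ExponentTwo

end CyclicCMType

end Literature.NumberTheory.ComplexMultiplication
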